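/-
Origin: expansion seat `planner-pub-hodgecm-pv13-g4-0`, handover #5 2026-08-18T10:44:43Z (`HOME/pub-hodgecm-pv13-g4/lean/Pv13g4/GenuineSchrodingerLevel.lean`, md5 a979914e, 392 lines);
landed by the gen-7 packager in gate run 28 as `HodgeCM/PerL34/GenuineSchrodingerLevel.lean` (import ^import Pv[0-9]+g[0-9]+\.→import HodgeCM.PerL34. ×1).
-/
/-
# pub-hodgecm-pv13-g4 · file #5 · `GenuineSchrodingerLevel` — the level-structure fields of the S3 input
# are consequences of the END theorem's own hypotheses (`hK`, `hχT'`, `hlocχ`)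

WIP of planner-pub-hodgecm-pv13-g4-0 (DAG-NODE PROVER #13, gen 4).  Intended tree location
`HodgeCM/PerL34/GenuineSchrodingerLevel.lean` (NEW leaf; imports my #4 `GenuineSchrodingerContinuity` via the ONE
rewrite `Pv13g4.GenuineSchrodingerContinuity` ↦ `HodgeCM.PerL34.GenuineSchrodingerContinuity`).

WHAT THIS FILE DOES.  #3 (`GenuineSchrodingerInput`) inhabits pv09-g5's S3 input `GenuineThetaInput` from
Schrödinger-model local data; its binder census (GAPS pv13g4-A3) listed, besides the definitional local data and the
restricted-tensor-product intertwiners, three CHOICE fields at the split places: `hsph` (`v ∉ S`: `1_{𝒪³}` is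
`𝒪ˣ`-spherical for `ω_v`), `hsm` (`v ∈ S`: `U₁` fixes `1_D`) and `hχS` (`v ∈ S`: `U₁ ⊂ ker χ_v`).  Here:

* §1 `GenuineSchrodingerInput₀ L S T T' …` = #3's structure WITHOUT `hsph` and with `hiso` asked only on `T ∪ T'`, and
  `GenuineSchrodingerInput₀.toInput hK hχT' hTS : GenuineSchrodingerInput …` — the sphericity field is a THEOREM under
  the END theorem's own level hypothesis `hK : ∀ k ∈ K_T, ω k φ = φ` (`T ⊆ S`): for `v ∉ S ⊇ T` and `‖u‖ = 1`,
  `g := baseTriv⁻¹ u ∈ genLevel` (`mem_genLevel_iff_norm_baseTriv_eq_one`), `ι_v g ∈ K_T`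
  (`RestrictedProduct.mulSingle_mem_boxSubgroup`), so `V_v(ω_v(u) 1_{𝒪³}) = ω(ι_v g) V_v 1_{𝒪³} = ω(ι_v g) φ = φ =
  V_v 1_{𝒪³}` and `V_v` is injective; and at a NON-SPLIT place off `T ∪ T'` the level is the whole local torus
  (`genLevel_eq_top_of_not_isSplitPlace`; tex l. 627), so `hK`, `hχT'` give `ω(ι_v g) φ = φ`, `χ(ι_v g) = 1` and the
  isotypy `ω(ι_v g) φ = conj χ(ι_v g) • φ` holds with both sides `φ` (`isotypy_of_not_mem_union`).  Headline
  `exists_compactDomain_thetaLift_ne_zero_genuine_of_schrodinger₀` = #3's headline at `X₀.toInput hK hχT' hTS`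
  (statement verbatim; the input is smaller).
* §2 `exists_radius_forall_U1_char_eq_one`: under the END hypotheses `hχT' : K_{T'} ≤ ker χ` and `hlocχ` (continuity of
  `χ ∘ ι_v` for `v ∈ T'`), at every split place and every centre `x₀ ≠ 0` there is `r₀ ∈ (0, ‖x₀‖)` with
  `χ(ι_v g) = 1` whenever `baseTriv g ∈ U1 x₀ r`, `0 < r ≤ r₀` — so #3's field `hχS`, like `hsm` (#4
  `exists_radius_forall_U1_ωv_ballIndicator_eq`), is available BY CHOICE of the radius; §3 combines the two
  (`exists_radius_forall_U1_level`: one radius serving `hsm` AND `hχS`, under `hloc`, `hχT'`, `hlocχ`).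

So of the split-place fields of the S3 input only the DEFINITIONAL local data (`ψ_v`, `ω_v` Levi-normalised), the
intertwiners `V_v` with `hV` / `hVφ` / `hVφS` (restricted tensor product, GAPS pv09g5-A2 / carverg2-X1) and the centres /
scalars `x₀_v`, `a_v` (`v ∈ S`) are inputs; the radius is a choice the END hypotheses make admissible, and `hiso`
at the non-split places of `T ∪ T'` (ramified for `(ω, φ)` or `χ`; the ramified infinite places included) is N31a PRINT.  Nothing is cited: class K (kernel) in the cell's K/P/M/PerL-internal classification.
Not used: PerL, QW8, [Y1]/[Y1w], any 2001-programme text.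
-/
import Summits.HodgeConjecture.HodgeCM.PerL34.GenuineSchrodingerContinuity

set_option linter.unusedSectionVars false
set_option linter.unusedVariables false
set_option linter.style.longLine false
set_option linter.style.header false
set_option linter.style.cdot false
set_option linter.style.setOption false
set_option linter.style.multiGoal false
set_option linter.flexible false

noncomputable section

open MeasureTheory MeasureTheory.Measure Set Metric Function Complex ComplexConjugate Topology Filter
open scoped RestrictedProduct InnerProductSpace NNReal ENNReal

namespace HodgeCM.PerL34.PureTensor

open HodgeCM.PerL34.SplitShells HodgeCM.PerL34.AdelicFactorisation HodgeCM.PerL34.RestrictedMeasure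
open HodgeCM.PerL34.NoSmallSubgroups HodgeCM.PerL34.EulerFactorisation HodgeCM.PerL34.DiscreteFD
open HodgeCM.PerL34.LocalFactors HodgeCM.PerL34.LocalFactors.DilationModel
open HodgeCM.PerL34.LocalFactors.SchrodingerLevi HodgeCM.PerL34.LocalFactors.SchrodingerIrreducible
open HodgeCM.PerL34.LocalModulus HodgeCM.PerL34.SplitPlaceDilation
open HodgeCM.PerL34.RallisIP HodgeCM.PerL34.Doubling HodgeCM.PerL34.N31d NumberField IsDedekindDomain
open HodgeCM.PerL34.IdelePlaces HodgeCM.PerL34.RestrictedRegroup HodgeCM.PerL34.RestrictedCutout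
open HodgeCM.PerL34.IdelicTorusModel HodgeCM.PerL34.IdelicTorusModel.Genuine

attribute [local instance] LocalFactors.DilationModel.Adic.nontriviallyNormedField
  LocalFactors.DilationModel.Adic.properSpace

/-! ## §1  The input without the sphericity field, and sphericity from `hK` -/

/-- #3's `GenuineSchrodingerInput` WITHOUT the field `hsph` (sphericity of `1_{𝒪³}` at the split `v ∉ S`), which
`GenuineSchrodingerInput₀.toInput` derives from the END theorem's level hypothesis `hK`, and with the isotypy field
`hiso` required ONLY at the non-split places of `T ∪ T'` (the places ramified for `(ω, φ)` resp. `χ`: off them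
`genLevel = ⊤`, so `hK`, `hχT'` give `ω(ι_v g) φ = φ`, `χ(ι_v g) = 1`).  The two extra parameters `T T'` are the END
theorem's own level sets; all other fields verbatim. -/
structure GenuineSchrodingerInput₀ (L : Type) [Field L] [NumberField L] [IsCMField L]
    [DecidableEq (Place (maximalRealSubfield L))]
    [∀ v : HeightOneSpectrum (𝓞 (maximalRealSubfield L)), MeasurableSpace (v.adicCompletion (maximalRealSubfield L))]
    [∀ v : HeightOneSpectrum (𝓞 (maximalRealSubfield L)), BorelSpace (v.adicCompletion (maximalRealSubfield L))]
    (S T T' : Finset (Place (maximalRealSubfield L)))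
    (Sp : Type) [NormedAddCommGroup Sp] [InnerProductSpace ℂ Sp]
    (ω : Model L →* (Sp ≃ₗᵢ[ℂ] Sp)) (φ : Sp) (χ : Model L →* Circle) where
  -- the local additive characters `ψ_v` (continuous, non-trivial at the split places)
  ψ : ∀ i : Place (maximalRealSubfield L), AddChar ((basePlaceOf L i).adicCompletion (maximalRealSubfield L)) Circle
  hψc : ∀ i, Continuous (ψ i)
  hψ1 : ∀ i, IsSplitPlace L i → ∃ t, ψ i t ≠ 1
  -- the local factor at a split place: a unitary representation of `(L⁺_v)ˣ` on `L²((L⁺_v)³)` …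
  ωv : ∀ i : Place (maximalRealSubfield L),
    ((basePlaceOf L i).adicCompletion (maximalRealSubfield L))ˣ →*
      (Lp ℂ 2 (Adic.muV (maximalRealSubfield L) (basePlaceOf L i)) ≃ₗᵢ[ℂ]
        Lp ℂ 2 (Adic.muV (maximalRealSubfield L) (basePlaceOf L i)))
  -- … normalising the Schrödinger system of `ψ_v` as the Levi factor does: translations …
  hτ : ∀ i, IsSplitPlace L i → ∀ (y : ((basePlaceOf L i).adicCompletion (maximalRealSubfield L))ˣ)
    (x : Fin 3 → (basePlaceOf L i).adicCompletion (maximalRealSubfield L))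
    (f : Lp ℂ 2 (Adic.muV (maximalRealSubfield L) (basePlaceOf L i))),
      ωv i y (translate (Adic.muV (maximalRealSubfield L) (basePlaceOf L i)) x f)
        = translate (Adic.muV (maximalRealSubfield L) (basePlaceOf L i)) (y⁻¹ • x) (ωv i y f)
  -- … and Heisenberg modulations `M_ξ f (u) = ψ_v(∑ ξ_k u_k) f(u)`
  hMod : ∀ i, IsSplitPlace L i → ∀ (y : ((basePlaceOf L i).adicCompletion (maximalRealSubfield L))ˣ)
    (ξ : Fin 3 → (basePlaceOf L i).adicCompletion (maximalRealSubfield L))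
    (f : Lp ℂ 2 (Adic.muV (maximalRealSubfield L) (basePlaceOf L i))),
      ωv i y (modulate (Adic.muV (maximalRealSubfield L) (basePlaceOf L i)) (heisChar (ψ i) (hψc i) ξ) f)
        = modulate (Adic.muV (maximalRealSubfield L) (basePlaceOf L i))
            ((heisChar (ψ i) (hψc i) ξ).comp (smulMap y)) (ωv i y f)
  -- the embedding of the local factor into `Sp`, intertwining `ω ∘ ι_v ∘ baseTriv⁻¹` with `ω_v`
  V : ∀ i, IsSplitPlace L i → (Lp ℂ 2 (Adic.muV (maximalRealSubfield L) (basePlaceOf L i)) →ₗᵢ[ℂ] Sp)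
  hV : ∀ i (hs : IsSplitPlace L i), ∀ (g : locTorus (maximalRealSubfield L) L i)
    (f : Lp ℂ 2 (Adic.muV (maximalRealSubfield L) (basePlaceOf L i))),
      ω (RestrictedProduct.mulSingle (genLevel L) i g) (V i hs f) = V i hs (ωv i (baseTriv L i hs g) f)
  -- split `v ∉ S`: `φ_v = 1_{𝒪³}` is the local component of `φ`, and is `𝒪ˣ`-spherical for `ω_v`
  hVφ : ∀ i (_ : i ∉ S) (hs : IsSplitPlace L i),
    V i hs (ballIndicator (Adic.muV (maximalRealSubfield L) (basePlaceOf L i)) 0 1) = φ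
  -- split `v ∈ S`: the ball `D = closedBall x₀ r`, the scalar `a`, `U₁ = U1 x₀ r` fixes `1_D`, `φ_v = a • 1_D`
  x₀ : ∀ i : Place (maximalRealSubfield L), Fin 3 → (basePlaceOf L i).adicCompletion (maximalRealSubfield L)
  r : Place (maximalRealSubfield L) → ℝ
  a : Place (maximalRealSubfield L) → ℂ
  hr : ∀ i ∈ S, IsSplitPlace L i → r i < ‖x₀ i‖
  hr0 : ∀ i ∈ S, IsSplitPlace L i → 0 < r i
  hsm : ∀ i ∈ S, IsSplitPlace L i → ∀ y : ((basePlaceOf L i).adicCompletion (maximalRealSubfield L))ˣ,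
    (y : (basePlaceOf L i).adicCompletion (maximalRealSubfield L)) ∈ U1 (x₀ i) (r i) →
      ωv i y (ballIndicator (Adic.muV (maximalRealSubfield L) (basePlaceOf L i)) (x₀ i) (r i))
        = ballIndicator (Adic.muV (maximalRealSubfield L) (basePlaceOf L i)) (x₀ i) (r i)
  hVφS : ∀ i (_ : i ∈ S) (hs : IsSplitPlace L i),
    V i hs (a i • ballIndicator (Adic.muV (maximalRealSubfield L) (basePlaceOf L i)) (x₀ i) (r i)) = φ
  hχS : ∀ i (_ : i ∈ S) (hs : IsSplitPlace L i), ∀ g : locTorus (maximalRealSubfield L) L i,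
    ((baseTriv L i hs g : ((basePlaceOf L i).adicCompletion (maximalRealSubfield L))ˣ) :
        (basePlaceOf L i).adicCompletion (maximalRealSubfield L)) ∈ U1 (x₀ i) (r i) →
      χ (RestrictedProduct.mulSingle (genLevel L) i g) = 1
  -- non-split `v ∈ S` RAMIFIED for `(ω, φ)` or for `χ` (i.e. `v ∈ T ∪ T'`; every ramified infinite place included):
  -- isotypy of `φ`.  (Off `T ∪ T'` it is automatic: `isotypy_of_not_mem_union` below.)
  hiso : ∀ i ∈ S, ¬IsSplitPlace L i → i ∈ T ∪ T' → ∀ g : locTorus (maximalRealSubfield L) L i,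
    ω (RestrictedProduct.mulSingle (genLevel L) i g) φ
      = conj (((χ (RestrictedProduct.mulSingle (genLevel L) i g) : Circle) : ℂ)) • φ

/-! ### Non-split places off `T ∪ T'`: the level is everything, so `φ` is fixed and `χ_v = 1` -/

section nonsplit

variable {L : Type} [Field L] [NumberField L] [IsCMField L]
  [DecidableEq (Place (maximalRealSubfield L))]
  {Sp : Type} [NormedAddCommGroup Sp] [InnerProductSpace ℂ Sp]
  {ω : Model L →* (Sp ≃ₗᵢ[ℂ] Sp)} {φ : Sp} {χ : Model L →* Circle}

/-- at a non-split place `v ∉ T` the WHOLE local torus fixes `φ` (`genLevel = ⊤` there: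
`genLevel_eq_top_of_not_isSplitPlace`, tex l. 627 "is compact and equals U(1)(𝒪_v)"). -/
theorem apply_eq_self_of_not_isSplitPlace {T : Finset (Place (maximalRealSubfield L))}
    (hK : ∀ k ∈ RestrictedProduct.boxSubgroup (genLevel L) T, ω k φ = φ)
    (i : Place (maximalRealSubfield L)) (hs : ¬IsSplitPlace L i) (hiT : i ∉ T)
    (g : locTorus (maximalRealSubfield L) L i) :
    ω (RestrictedProduct.mulSingle (genLevel L) i g) φ = φ := by
  have hg : g ∈ genLevel L i := by rw [genLevel_eq_top_of_not_isSplitPlace L i hs]; trivial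
  exact hK _ (RestrictedProduct.mulSingle_mem_boxSubgroup T hiT hg)

/-- at a non-split place `v ∉ T'` the local character `χ ∘ ι_v` is trivial (tex ll. 626–628 "so `χ'_v = 1` there"). -/
theorem char_eq_one_of_not_isSplitPlace {T' : Finset (Place (maximalRealSubfield L))}
    (hχT' : RestrictedProduct.boxSubgroup (genLevel L) T' ≤ χ.ker)
    (i : Place (maximalRealSubfield L)) (hs : ¬IsSplitPlace L i) (hiT' : i ∉ T')
    (g : locTorus (maximalRealSubfield L) L i) :
    χ (RestrictedProduct.mulSingle (genLevel L) i g) = 1 := by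
  have hg : g ∈ genLevel L i := by rw [genLevel_eq_top_of_not_isSplitPlace L i hs]; trivial
  exact MonoidHom.mem_ker.mp (hχT' (RestrictedProduct.mulSingle_mem_boxSubgroup T' hiT' hg))

/-- **isotypy is automatic at the non-split places off `T ∪ T'`**: both sides are `φ`. -/
theorem isotypy_of_not_mem_union {T T' : Finset (Place (maximalRealSubfield L))}
    (hK : ∀ k ∈ RestrictedProduct.boxSubgroup (genLevel L) T, ω k φ = φ)
    (hχT' : RestrictedProduct.boxSubgroup (genLevel L) T' ≤ χ.ker)
    (i : Place (maximalRealSubfield L)) (hs : ¬IsSplitPlace L i) (hi : i ∉ T ∪ T')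
    (g : locTorus (maximalRealSubfield L) L i) :
    ω (RestrictedProduct.mulSingle (genLevel L) i g) φ
      = conj (((χ (RestrictedProduct.mulSingle (genLevel L) i g) : Circle) : ℂ)) • φ := by
  rw [Finset.notMem_union] at hi
  rw [apply_eq_self_of_not_isSplitPlace hK i hs hi.1, char_eq_one_of_not_isSplitPlace hχT' i hs hi.2,
    Circle.coe_one, map_one, one_smul]

end nonsplit

namespace GenuineSchrodingerInput₀

variable {L : Type} [Field L] [NumberField L] [IsCMField L]
  [DecidableEq (Place (maximalRealSubfield L))]
  [∀ v : HeightOneSpectrum (𝓞 (maximalRealSubfield L)), MeasurableSpace (v.adicCompletion (maximalRealSubfield L))]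
  [∀ v : HeightOneSpectrum (𝓞 (maximalRealSubfield L)), BorelSpace (v.adicCompletion (maximalRealSubfield L))]
  {S T T' : Finset (Place (maximalRealSubfield L))}
  {Sp : Type} [NormedAddCommGroup Sp] [InnerProductSpace ℂ Sp]
  {ω : Model L →* (Sp ≃ₗᵢ[ℂ] Sp)} {φ : Sp} {χ : Model L →* Circle}
  (X₀ : GenuineSchrodingerInput₀ L S T T' Sp ω φ χ)

/-- **sphericity of `φ_v = 1_{𝒪³}` at the split `v ∉ S` is a consequence of the level hypothesis `hK`** (`T ⊆ S`):
`V_v (ω_v(u) 1_{𝒪³}) = ω(ι_v (baseTriv⁻¹ u)) φ = φ = V_v 1_{𝒪³}` for `‖u‖ = 1`, and `V_v` is injective. -/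
theorem ωv_ballIndicator_eq_of_level
    (hK : ∀ k ∈ RestrictedProduct.boxSubgroup (genLevel L) T, ω k φ = φ) (hTS : T ⊆ S)
    (i : Place (maximalRealSubfield L)) (hi : i ∉ S) (hs : IsSplitPlace L i)
    (u : ((basePlaceOf L i).adicCompletion (maximalRealSubfield L))ˣ)
    (hu : ‖(u : (basePlaceOf L i).adicCompletion (maximalRealSubfield L))‖ = 1) :
    X₀.ωv i u (ballIndicator (Adic.muV (maximalRealSubfield L) (basePlaceOf L i)) 0 1)
      = ballIndicator (Adic.muV (maximalRealSubfield L) (basePlaceOf L i)) 0 1 := by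
  set g : locTorus (maximalRealSubfield L) L i := (baseTriv L i hs).symm u with hg
  have hgu : baseTriv L i hs g = u := by rw [hg, ContinuousMulEquiv.apply_symm_apply]
  have hgK : g ∈ genLevel L i := (mem_genLevel_iff_norm_baseTriv_eq_one L i hs g).2 (by rw [hgu]; exact hu)
  have hiT : i ∉ T := fun h => hi (hTS h)
  have h1 := hK _ (RestrictedProduct.mulSingle_mem_boxSubgroup T hiT hgK)
  rw [← X₀.hVφ i hi hs, X₀.hV i hs, hgu] at h1
  exact (X₀.V i hs).injective h1

/-- **the full S3 input of #3 from `X₀` and the level hypotheses `hK` (`T ⊆ S`) and `hχT'`.** -/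
def toInput
    (hK : ∀ k ∈ RestrictedProduct.boxSubgroup (genLevel L) T, ω k φ = φ)
    (hχT' : RestrictedProduct.boxSubgroup (genLevel L) T' ≤ χ.ker) (hTS : T ⊆ S) :
    GenuineSchrodingerInput L S Sp ω φ χ where
  ψ := X₀.ψ
  hψc := X₀.hψc
  hψ1 := X₀.hψ1
  ωv := X₀.ωv
  hτ := X₀.hτ
  hMod := X₀.hMod
  V := X₀.V
  hV := X₀.hV
  hVφ := X₀.hVφ
  hsph := X₀.ωv_ballIndicator_eq_of_level hK hTS
  x₀ := X₀.x₀
  r := X₀.r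
  a := X₀.a
  hr := X₀.hr
  hr0 := X₀.hr0
  hsm := X₀.hsm
  hVφS := X₀.hVφS
  hχS := X₀.hχS
  hiso := fun i hi hs g => by
    by_cases h : i ∈ T ∪ T'
    · exact X₀.hiso i hi hs h g
    · exact isotypy_of_not_mem_union hK hχT' i hs h g

/-- (Ported verbatim from the HodgeCMPerL package; no docstring in the source.) -/
@[simp] theorem toInput_ωv
    (hK : ∀ k ∈ RestrictedProduct.boxSubgroup (genLevel L) T, ω k φ = φ)
    (hχT' : RestrictedProduct.boxSubgroup (genLevel L) T' ≤ χ.ker) (hTS : T ⊆ S) :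
    (X₀.toInput hK hχT' hTS).ωv = X₀.ωv := rfl

/-- (Ported verbatim from the HodgeCMPerL package; no docstring in the source.) -/
@[simp] theorem toInput_V
    (hK : ∀ k ∈ RestrictedProduct.boxSubgroup (genLevel L) T, ω k φ = φ)
    (hχT' : RestrictedProduct.boxSubgroup (genLevel L) T' ≤ χ.ker) (hTS : T ⊆ S) :
    (X₀.toInput hK hχT' hTS).V = X₀.V := rfl

end GenuineSchrodingerInput₀

/-! ## §2  `U₁ ⊂ ker χ_v` by choice of the radius, from `hχT'` and `hlocχ` -/

section charRadius

variable {L : Type} [Field L] [NumberField L] [IsCMField L]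
  [DecidableEq (Place (maximalRealSubfield L))]
  {χ : Model L →* Circle}

/-- **tex ll. 617–621 "N so large that U₁ ⊂ ker χ_v" from the END hypotheses**: if `K_{T'} ≤ ker χ` and `χ ∘ ι_v` is
continuous for `v ∈ T'`, then at every split place `v` and every centre `x₀ ≠ 0` there is `r₀ ∈ (0, ‖x₀‖)` such that
`χ(ι_v g) = 1` whenever `baseTriv g ∈ U1 x₀ r`, `0 < r ≤ r₀`.  (For `v ∉ T'` any `r₀ < ‖x₀‖` works: `U1 x₀ r ⊆ 𝒪ˣ`,
so `g ∈ genLevel` and `ι_v g ∈ K_{T'}`; for `v ∈ T'` it is `KernelRadius` for the continuous character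
`χ ∘ ι_v ∘ baseTriv⁻¹` of `(L⁺_v)ˣ`, via #4 `exists_radius_forall_U1_eq_one_of_continuous`.) -/
theorem exists_radius_forall_U1_char_eq_one {T' : Finset (Place (maximalRealSubfield L))}
    (hχT' : RestrictedProduct.boxSubgroup (genLevel L) T' ≤ χ.ker)
    (hlocχ : ∀ i ∈ T', Continuous fun g : locTorus (maximalRealSubfield L) L i =>
      χ (RestrictedProduct.mulSingle (genLevel L) i g))
    (i : Place (maximalRealSubfield L)) (hs : IsSplitPlace L i)
    {x₀ : Fin 3 → (basePlaceOf L i).adicCompletion (maximalRealSubfield L)} (hx : x₀ ≠ 0) :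
    ∃ r₀ : ℝ, 0 < r₀ ∧ r₀ < ‖x₀‖ ∧ ∀ r : ℝ, 0 < r → r ≤ r₀ →
      ∀ g : locTorus (maximalRealSubfield L) L i,
        ((baseTriv L i hs g : ((basePlaceOf L i).adicCompletion (maximalRealSubfield L))ˣ) :
            (basePlaceOf L i).adicCompletion (maximalRealSubfield L)) ∈ U1 x₀ r →
          χ (RestrictedProduct.mulSingle (genLevel L) i g) = 1 := by
  by_cases hiT : i ∈ T'
  · -- the continuous character `χ_v := χ ∘ ι_v ∘ baseTriv⁻¹` of `(L⁺_v)ˣ`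
    set χv : ((basePlaceOf L i).adicCompletion (maximalRealSubfield L))ˣ →* Circle :=
      (χ.comp (inclHom (genLevel L) i)).comp
        ((baseTriv L i hs).symm : ((basePlaceOf L i).adicCompletion (maximalRealSubfield L))ˣ →*
          locTorus (maximalRealSubfield L) L i) with hχv
    have hχvc : Continuous χv := by
      rw [hχv]
      exact (hlocχ i hiT).comp (baseTriv L i hs).symm.continuous
    obtain ⟨r₀, hr₀, hr₀x, h⟩ :=
      GenuineSchrodingerInput.exists_radius_forall_U1_eq_one_of_continuous (n := 3) χv hχvc hx
    refine ⟨r₀, hr₀, hr₀x, fun r hr hrr g hg => ?_⟩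
    have h1 := h r hr hrr (baseTriv L i hs g) hg
    have h2 : χv (baseTriv L i hs g) = χ (RestrictedProduct.mulSingle (genLevel L) i g) := by
      rw [hχv, MonoidHom.comp_apply, MonoidHom.comp_apply, inclHom_apply, MonoidHom.coe_coe,
        ContinuousMulEquiv.symm_apply_apply]
    rw [h2] at h1
    exact h1
  · have hx' : 0 < ‖x₀‖ := norm_pos_iff.2 hx
    refine ⟨‖x₀‖ / 2, by positivity, by linarith, fun r hr hrr g hg => ?_⟩
    have hn := norm_eq_one_of_mem_U1 (lt_of_le_of_lt hrr (by linarith)) hg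
    have hgK : g ∈ genLevel L i := (mem_genLevel_iff_norm_baseTriv_eq_one L i hs g).2 hn
    exact MonoidHom.mem_ker.mp (hχT' (RestrictedProduct.mulSingle_mem_boxSubgroup T' hiT hgK))

end charRadius

/-! ## §3  One admissible radius for both `hsm` and `hχS` -/

namespace GenuineSchrodingerInput

variable {L : Type} [Field L] [NumberField L] [IsCMField L]
  [DecidableEq (Place (maximalRealSubfield L))]
  [∀ v : HeightOneSpectrum (𝓞 (maximalRealSubfield L)), MeasurableSpace (v.adicCompletion (maximalRealSubfield L))]
  [∀ v : HeightOneSpectrum (𝓞 (maximalRealSubfield L)), BorelSpace (v.adicCompletion (maximalRealSubfield L))]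
  {S : Finset (Place (maximalRealSubfield L))}
  {Sp : Type} [NormedAddCommGroup Sp] [InnerProductSpace ℂ Sp]
  {ω : Model L →* (Sp ≃ₗᵢ[ℂ] Sp)} {φ : Sp} {χ : Model L →* Circle}
  (X : GenuineSchrodingerInput L S Sp ω φ χ)

/-- **admissible radii (tex ll. 617–621, both halves)**: under the END hypotheses `hloc`, `hχT'`, `hlocχ`, at a split
place `v` and a centre `x₀ ≠ 0` there is `r₀ ∈ (0, ‖x₀‖)` such that for EVERY `0 < r ≤ r₀` both `ω_v(y) 1_D = 1_D`
for `y ∈ U1 x₀ r` (`D = closedBall x₀ r`; the content of the field `hsm`) and `χ(ι_v g) = 1` for `baseTriv g ∈ U1 x₀ r`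
(the content of the field `hχS`) hold. -/
theorem exists_radius_forall_U1_level (i : Place (maximalRealSubfield L)) (hs : IsSplitPlace L i)
    (hloc : ∀ v : Sp, Continuous fun g : locTorus (maximalRealSubfield L) L i =>
      ω (RestrictedProduct.mulSingle (genLevel L) i g) v)
    {T' : Finset (Place (maximalRealSubfield L))}
    (hχT' : RestrictedProduct.boxSubgroup (genLevel L) T' ≤ χ.ker)
    (hlocχ : ∀ i ∈ T', Continuous fun g : locTorus (maximalRealSubfield L) L i =>
      χ (RestrictedProduct.mulSingle (genLevel L) i g))
    {x₀ : Fin 3 → (basePlaceOf L i).adicCompletion (maximalRealSubfield L)} (hx : x₀ ≠ 0) :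
    ∃ r₀ : ℝ, 0 < r₀ ∧ r₀ < ‖x₀‖ ∧ ∀ r : ℝ, 0 < r → r ≤ r₀ →
      (∀ y : ((basePlaceOf L i).adicCompletion (maximalRealSubfield L))ˣ,
        (y : (basePlaceOf L i).adicCompletion (maximalRealSubfield L)) ∈ U1 x₀ r →
          X.ωv i y (ballIndicator (Adic.muV (maximalRealSubfield L) (basePlaceOf L i)) x₀ r)
            = ballIndicator (Adic.muV (maximalRealSubfield L) (basePlaceOf L i)) x₀ r) ∧
      (∀ g : locTorus (maximalRealSubfield L) L i,
        ((baseTriv L i hs g : ((basePlaceOf L i).adicCompletion (maximalRealSubfield L))ˣ) :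
            (basePlaceOf L i).adicCompletion (maximalRealSubfield L)) ∈ U1 x₀ r →
          χ (RestrictedProduct.mulSingle (genLevel L) i g) = 1) := by
  obtain ⟨r₁, hr₁, hr₁x, h₁⟩ := X.exists_radius_forall_U1_ωv_ballIndicator_eq i hs hloc hx
  obtain ⟨r₂, hr₂, hr₂x, h₂⟩ := exists_radius_forall_U1_char_eq_one hχT' hlocχ i hs hx
  refine ⟨min r₁ r₂, lt_min hr₁ hr₂, lt_of_le_of_lt (min_le_left _ _) hr₁x, fun r hr hrr => ⟨?_, ?_⟩⟩
  · exact h₁ r hr (hrr.trans (min_le_left _ _))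
  · exact h₂ r hr (hrr.trans (min_le_right _ _))

end GenuineSchrodingerInput

/-! ## §4  The S3 headline from the smaller input -/

section ofSchrodinger₀

variable (L : Type) [Field L] [NumberField L] [IsCMField L]

variable [DecidableEq (Place (maximalRealSubfield L))]
  [∀ v : HeightOneSpectrum (𝓞 (maximalRealSubfield L)), MeasurableSpace (v.adicCompletion (maximalRealSubfield L))]
  [∀ v : HeightOneSpectrum (𝓞 (maximalRealSubfield L)), BorelSpace (v.adicCompletion (maximalRealSubfield L))]
  (S₀ : Finset (Place (maximalRealSubfield L)))
  {Sp : Type} [NormedAddCommGroup Sp] [InnerProductSpace ℂ Sp]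
  {W : Type} [AddCommGroup W] [Module L W]
  {H Sbox : Type} [Group H] [AddCommGroup Sbox] [Module ℂ Sbox]
  {h : W →ₗ⋆[L] W →ₗ[L] L} (hW : IsLine L W) (hh : Anisotropic h)
  (D : DoublingDatum (Model L) H Sp Sbox) (GU : ThetaSide Sp Sbox)
  (j : isomBox h →* H) (hj : ∀ d : unitary L, j ⟨iotaSnd d, iotaSnd_mem h d⟩ = D.ι (1, unitaryToModel L d))
  (χ : Model L →* Circle) (hχΓ : ∀ d : unitary L, χ (unitaryToModel L d) = 1)
  (hχVΓ : ∀ d : unitary L, D.χV (unitaryToModel L d) = 1)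
  {hP : ∀ Ψ : Sbox, ∀ p ∈ (stabDelta L W).subgroupOf (isomBox h), ∀ x : H,
    D.fSW Ψ (j p * x) = D.fSW Ψ x}
  (P : GluePrintInputs D GU h j hP) (φ : Sp)
  (hφ : ‖φ‖ = 1)
  (hloc : ∀ (i : Place (maximalRealSubfield L)) (v : Sp),
    Continuous fun g : locTorus (maximalRealSubfield L) L i => D.ω (RestrictedProduct.mulSingle (genLevel L) i g) v)
  {T' : Finset (Place (maximalRealSubfield L))} (hχT' : RestrictedProduct.boxSubgroup (genLevel L) T' ≤ χ.ker)
  (hlocχ : ∀ i ∈ T', Continuous fun g : locTorus (maximalRealSubfield L) L i => χ (RestrictedProduct.mulSingle (genLevel L) i g))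
  {T : Finset (Place (maximalRealSubfield L))} (hK : ∀ k ∈ RestrictedProduct.boxSubgroup (genLevel L) T, D.ω k φ = φ)
  (hM : ∀ S : Finset (Place (maximalRealSubfield L)), T ⊆ S → ∀ y : (i : ↥S) → locTorus (maximalRealSubfield L) L i,
    inner ℂ φ (D.ω (extendOne (genLevel L) S y) φ) = ∏ i : ↥S, localCoeff (genLevel L) D.ω φ i (y i))
  {S : Finset (Place (maximalRealSubfield L))} (hTS : T ⊆ S) (hT'S : T' ⊆ S)
  (hS : ∀ v : InfinitePlace (maximalRealSubfield L), Sum.inl v ∈ S)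

include hW hh hj hχΓ hχVΓ P hφ hloc hK hM hTS hT'S hS

set_option synthInstance.maxHeartbeats 200000 in
-- (as in #3: the `SMul Γ (Model L)` instance behind `IsFundamentalDomain` is slow to find at these types)
/-- **S3 HEADLINE FROM THE SMALLER SCHRÖDINGER INPUT** (PerL v5 L4.2(b), tex ll. 600–640): #3's
`exists_compactDomain_thetaLift_ne_zero_genuine_of_schrodinger` at `X₀.toInput hK hχT' hTS` — the sphericity of
`φ_v = 1_{𝒪³}` (`v ∉ S` split) and the isotypy at the non-split `v ∈ S` off `T ∪ T'` are no longer inputs but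
consequences of the theorem's own hypotheses `hK`, `hχT'`. -/
theorem exists_compactDomain_thetaLift_ne_zero_genuine_of_schrodinger₀ [IsFiniteMeasure GU.μ]
    (X₀ : GenuineSchrodingerInput₀ L S T T' Sp D.ω φ χ) :
    ∃ 𝓕 : Set (Model L), IsCompact 𝓕 ∧ (interior 𝓕).Nonempty ∧ MeasurableSet 𝓕 ∧
      IsFundamentalDomain (unitaryToModel L).range 𝓕 (haarDatum (genLevel L) (isCompact_genLevel L) (isOpen_genLevel L) S₀).μ ∧
      (haarDatum (genLevel L) (isCompact_genLevel L) (isOpen_genLevel L) S₀).μ 𝓕 ≠ 0 ∧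
      (haarDatum (genLevel L) (isCompact_genLevel L) (isOpen_genLevel L) S₀).μ 𝓕 ≠ ⊤ ∧
      ∀ [IsFiniteMeasure (((haarDatum (genLevel L) (isCompact_genLevel L) (isOpen_genLevel L) S₀).μ).restrict 𝓕)]
        (hk : Measurable (Function.uncurry (thetaFn D GU φ))) {Ck : ℝ} (hCk : 0 ≤ Ck)
        (hkC : ∀ q u, ‖thetaFn D GU φ q u‖ ≤ Ck),
        PeterssonFubini.theta GU.μ (((haarDatum (genLevel L) (isCompact_genLevel L) (isOpen_genLevel L) S₀).μ).restrict 𝓕) hk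
          (measurable_coe_char (genLevel L) (isOpen_genLevel L) χ hχT' hlocχ) hCk hkC (norm_coe_char_le χ) ≠ 0 :=
  exists_compactDomain_thetaLift_ne_zero_genuine_of_schrodinger L S₀ hW hh D GU j hj χ hχΓ hχVΓ P φ hφ hloc hχT' hlocχ hK
    hM hTS hT'S hS (X₀.toInput hK hχT' hTS)

end ofSchrodinger₀

end HodgeCM.PerL34.PureTensor

end
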